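import Mathlib
import Summits.NavierStokesRegularity.NavierStokesRegularity.Theorems.SqueezeCycleExtremalElementExistsRegularity
import Literature.Analysis.FluidPDE.TypeIAncientMild
import Literature.Analysis.FluidPDE.TypeIAncientMildClassical
import Literature.Analysis.FluidPDE.ClassicalSolution
import HarnessLib

/-!
# Window package of a Type-I ancient mild field (line `Sketch`, crux `RecurrentLiouville`)

On a compact window `[t₀, t₁] ⊂ (−∞, 0)` a Type-I ancient mild field `v ∈ A_C` is a classical
Navier–Stokes solution for some smooth pressure, with `v` and its spatial derivatives of orders
`≤ 3` bounded — the hypotheses of the adjoint-duality stubs `stub_clockAdjointPairing`,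
`stub_clockAdjointMass`.
-/

noncomputable section

set_option linter.dupNamespace false

namespace Summit.NavierStokesRegularity.NavierStokesRegularity.Theorems

open MeasureTheory Set Function Filter Topology TopologicalSpace Metric
open Literature.Analysis Literature.Analysis.FluidPDE
open scoped NNReal ENNReal RealInnerProductSpace

/-- **Bounded derivatives of orders `≤ 3` on a compact window** for `v ∈ A_C` (KNSS 2009, (4.10),
class-uniform form `exists_norm_iteratedFDeriv_le_of_typeI`, on the window `[t₀, t₁] ⊆ [(t₀−1)+1, t₁/2)`). -/
theorem clockWP_bounds {C : ℝ} {v : ℝ → EuclideanSpace ℝ (Fin 3) → EuclideanSpace ℝ (Fin 3)}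
    (hv : IsTypeIAncientMild C v) {t₀ t₁ : ℝ} (h01 : t₀ < t₁) (h1 : t₁ < 0) :
    ∃ B : ℝ, ∀ t ∈ Set.Icc t₀ t₁, ∀ x : EuclideanSpace ℝ (Fin 3),
      ‖v t x‖ ≤ B ∧ ‖fderiv ℝ (v t) x‖ ≤ B ∧ ‖iteratedFDeriv ℝ 2 (v t) x‖ ≤ B ∧
        ‖iteratedFDeriv ℝ 3 (v t) x‖ ≤ B := by
  have hab : t₀ - 1 < t₁ / 2 := by linarith
  have hb : t₁ / 2 < 0 := by linarith
  have hwin : ∀ t ∈ Set.Icc t₀ t₁, t ∈ Ico (t₀ - 1 + 1) (t₁ / 2) := fun t ht =>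
    ⟨by linarith [ht.1], by linarith [ht.2]⟩
  have key : ∀ k : ℕ, ∃ K : ℝ, ∀ t ∈ Set.Icc t₀ t₁, ∀ x, ‖iteratedFDeriv ℝ k (v t) x‖ ≤ K := by
    intro k
    obtain ⟨K, hK⟩ := exists_norm_iteratedFDeriv_le_of_typeI C k hab hb one_pos
    exact ⟨K, fun t ht x => hK hv.continuousOn_uncurry (fun s hs => hv.isWeaklyDivFree hs)
      (fun s r hsr hr y => hv.mild_eq_heatExtension hsr hr y) hv.hasTypeITimeDecay t (hwin t ht) x⟩
  obtain ⟨K0, hK0⟩ := key 0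
  obtain ⟨K1, hK1⟩ := key 1
  obtain ⟨K2, hK2⟩ := key 2
  obtain ⟨K3, hK3⟩ := key 3
  refine ⟨max (max K0 K1) (max K2 K3), fun t ht x => ⟨?_, ?_, ?_, ?_⟩⟩
  · have h := hK0 t ht x
    rw [norm_iteratedFDeriv_zero] at h
    exact h.trans ((le_max_left _ _).trans (le_max_left _ _))
  · have h := hK1 t ht x
    rw [norm_iteratedFDeriv_one] at h
    exact h.trans ((le_max_right _ _).trans (le_max_left _ _))
  · exact (hK2 t ht x).trans ((le_max_left _ _).trans (le_max_right _ _))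
  · exact (hK3 t ht x).trans ((le_max_right _ _).trans (le_max_right _ _))

/-- **Classical on a compact window**: `v ∈ A_C` is a classical Navier–Stokes solution (`ν = 1`,
`f = 0`) on `[t₀, t₁]`, `t₀ < t₁ < 0`, for some smooth pressure (classical on `(t₀ − 1, 0)`,
`IsTypeIAncientMild.exists_isClassicalNSSolutionOn_Ioo`, restricted with `IsClassicalNSSolutionOn.mono`). -/
theorem clockWP_classical {C : ℝ} {v : ℝ → EuclideanSpace ℝ (Fin 3) → EuclideanSpace ℝ (Fin 3)}
    (hv : IsTypeIAncientMild C v) {t₀ t₁ : ℝ} (h01 : t₀ < t₁) (h1 : t₁ < 0) :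
    ∃ q : ℝ → EuclideanSpace ℝ (Fin 3) → ℝ, IsClassicalNSSolutionOn (Set.Icc t₀ t₁) 1 0 v q := by
  obtain ⟨q, hq⟩ := hv.exists_isClassicalNSSolutionOn_Ioo (t₀ := t₀ - 1) (by linarith)
  exact ⟨q, hq.mono (fun t ht => ⟨by linarith [ht.1], by linarith [ht.2, h1]⟩) (uniqueDiffOn_Icc h01)⟩

/-- **Registered tools stub `stub_clockWindowBounds`** (explicit-binder form of `clockWP_bounds`):
bounded derivatives of orders `≤ 3` on compact windows for the Type-I ancient mild class. -/
theorem stub_clockWindowBounds :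
    ∀ (C : ℝ) (v : ℝ → EuclideanSpace ℝ (Fin 3) → EuclideanSpace ℝ (Fin 3)),
      IsTypeIAncientMild C v → ∀ (t₀ t₁ : ℝ), t₀ < t₁ → t₁ < 0 →
      ∃ B : ℝ, ∀ t ∈ Set.Icc t₀ t₁, ∀ x : EuclideanSpace ℝ (Fin 3),
        ‖v t x‖ ≤ B ∧ ‖fderiv ℝ (v t) x‖ ≤ B ∧ ‖iteratedFDeriv ℝ 2 (v t) x‖ ≤ B ∧
          ‖iteratedFDeriv ℝ 3 (v t) x‖ ≤ B :=
  fun _ _ hv _ _ h01 h1 => clockWP_bounds hv h01 h1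

end Summit.NavierStokesRegularity.NavierStokesRegularity.Theorems

end
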